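import Literature.AlgebraicGeometry.Resolution.KangarooAtlasCertCentres

/-!
# Kernel-checked rows for the adapted numbers `(H, ε, ω)` of Cossart–Piltant on the kangaroo atlas

Computable companion (sparse exponent lists over `𝔽_p`, as in `KangarooAtlasCert`; the initial form
`initialForm` is the one of `KangarooAtlasCertCentres`) of the
statement-level typing in `PointBlowupAdaptedOrder`: for a purely inseparable hypersurface
`h = Z^q + F(u₁,…,u_m)` kept CLEANED (so that, for `q = p`, the Newton polyhedron of `F/p` is
Hironaka's minimal characteristic polyhedron: every vertex is non-solvable) and a boundary
`E ⊆ {1,…,m}` of coordinate hyperplanes, the numbers of [CoP 2019, ch. 2] specialise to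

* `H_j = min {a_j : u^a ∈ supp F}` for `j ∈ E` (`H_j = p d_j`, Def. 2.10 with Prop. 2.8),
* `ε = ord F − Σ_{j∈E} H_j` (`ε(x) = p δ(x) − Σ H_j`, Def. 2.10 / (1.8) of the introduction),
* `F_{p,Z}` = the lowest-degree form of `F` (`in_{m_S} h = Z^p + F_{p,Z}` when `G = 0`, Thm. 2.14 (1)),
* `V ≠ 0 ⟺ ∂F_{p,Z}/∂U_j ≠ 0` for some `j ∉ E` `⟺` some monomial of `F_{p,Z}` has an exponent
  `a_j ≢ 0 (mod p)` at a non-boundary variable (Prop. 2.16 (i)),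
* `ω = ε − 1` if `V ≠ 0`, `ω = ε` otherwise (Def. 2.16 with `G = 0`, formula (1.10) of the introduction),

and the boundary is transported along a point blow-up by `E' = {new exceptional component} ∪
{strict transforms of the old components through the point}` [CoP 2019, Prop. 2.13 / notations
of Thm. 3.6: `E' = div(u₁ ⋯ u_{e'} u_{n₀})`].  The cone test of Thm. 3.6 (second clause,
`κ(x) ≥ 2`, here `G = 0`): `Max(x) = Max(V(F_{p,Z},E))` if `ω = ε − 1`, `= Max(J(F_{p,Z},E))` if
`ω = ε`, with `V = H⁻¹⟨∂F_{p,Z}/∂U_j : j ∉ E⟩`, `J = H⁻¹⟨U_j ∂F_{p,Z}/∂U_j : j ∈ E⟩` (proof of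
Prop. 2.16) and `v ∈ Max(G) ⟺ G(U + v) = G(U)`; the point `b` of the chart `u_j` has direction
`e_j + Σ b_i e_i`.  The directrix test of [CossartJannsenSaito2020, Def. 3.13 / Thm. 3.14] for `ord F = p`:
the direction `v` lies in `Dir_x(X)` iff `F_{p,Z}(U + v) = F_{p,Z}(U) + F_{p,Z}(v)`.

Certified rows (all `decide`): Hauser's kangaroo `x² + y⁷ + yz⁴` (shade `5,2,2,3`, adapted
`ε = 5,2,2,3`, `ω = 4,2,2,2`: the kangaroo is an `ω`-STALL and its direction lies on `Max(x)`,
the origin of the same chart does not); the two printed values of [CoP 2019, Rem. 2.6]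
(`ω = p + 2` for `c = 0`, `p + 1` for `c ≠ 0`; instances `p = 3, 5`) and of [CoP 2019, Rem. 3.2]
(`ω(x) = p`, `ω(x') = p + 1`; instance `p = 3`); and the atlas' `q = 4` row `x⁴ + y⁹ + z¹⁰`
over `𝔽₂` where the `p`-derivative analogue of `ω` INCREASES `1 → 2` at a kangaroo point while
the `q`-Hasse analogue stalls — outside the scope `m(x) = p` of [CoP 2019].

This is a CERTIFICATE of finitely many evaluations of published formulas in given coordinates,
not a theorem about resolution; the identification "cleaned ⟹ well prepared at the vertex
`δ(x)`" is the atlas convention recorded in its INVARIANTS document.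
-/

namespace Literature.AlgebraicGeometry.Resolution.KangarooAtlasCert

/-! ## The adapted numbers -/

/-- least exponent of the variable `u_j` over the terms of `P` (`0` for the empty list, never used there). [folklore] -/
def minExp (P : Poly) (j : ℕ) : ℕ :=
  match P with
  | [] => 0
  | t :: rest => rest.foldl (fun a s => min a (s.1.getD j 0)) (t.1.getD j 0)

/-- the vector `H = (H_j)`, `H_j = min_{a ∈ supp F} a_j` for `j ∈ E` and `0` off the boundary
(`H_j = p·d_j`, `d_j = min{a_j/i}` over the polyhedron; here `i = p` only). [cite: CossartPiltant2019, Def. 2.10] -/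
def hVec (m : ℕ) (E : List ℕ) (P : Poly) : List ℕ :=
  (List.range m).map (fun j => if E.contains j then minExp P j else 0)

/-- `ε = ord F − Σ_{j∈E} H_j` (`= p δ(x) − Σ H_j`). [cite: CossartPiltant2019, Def. 2.10] -/
def eps (m : ℕ) (E : List ℕ) (P : Poly) : ℕ := ord P - (hVec m E P).sum

/-- `V(F_{p,Z},E) ≠ 0`: some monomial of the initial form has an exponent `≢ 0 (mod md)` at a
variable off the boundary (`md = p`: `∂F_{p,Z}/∂U_j ≠ 0` for some `j ∉ E`; `md = q` is the
Hasse-derivative analogue used only for the `q > p` rows). [cite: CossartPiltant2019, Prop. 2.16] -/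
def vNonzero (md m : ℕ) (E : List ℕ) (P : Poly) : Bool :=
  (initialForm P).any (fun t => (List.range m).any (fun j => !(E.contains j) && t.1.getD j 0 % md != 0))

/-- `ω = ε − 1` if `V ≠ 0`, else `ω = ε` (case `G = 0`), with derivative modulus `md`. [cite: CossartPiltant2019, Def. 2.16] -/
def omegaMod (md m : ℕ) (E : List ℕ) (P : Poly) : ℕ :=
  if vNonzero md m E P then eps m E P - 1 else eps m E P

/-- Cossart–Piltant's adapted order `ω` (`md = p`). [cite: CossartPiltant2019, Def. 2.16] -/
def omega (p m : ℕ) (E : List ℕ) (P : Poly) : ℕ := omegaMod p m E P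

/-- transport of the boundary through the point `b` of the chart `u_j`: the new exceptional
component `u_j = 0` and the strict transforms of the old components through the point. [cite: CossartPiltant2019, Prop. 2.13] -/
def newBoundary (j : ℕ) (b : List ℕ) (E : List ℕ) : List ℕ :=
  j :: E.filter (fun i => i != j && b.getD i 0 == 0)

/-- the triples `(shade, ε, ω)` along a scripted path, boundary transported from `E`
(`none` once a step is not `q`-fold). [folklore] -/
def trace (p q m : ℕ) (E : List ℕ) (s : State) : List (ℕ × List ℕ) → List (Option (ℕ × ℕ × ℕ))
  | [] => [some (shade s, eps m E s.F, omega p m E s.F)]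
  | (j, b) :: rest =>
      match step p q s j b with
      | none => [some (shade s, eps m E s.F, omega p m E s.F), none]
      | some s' => some (shade s, eps m E s.F, omega p m E s.F) :: trace p q m (newBoundary j b E) s' rest

/-! ## The cone `Max(x)` and the directrix test -/

/-- `∂P/∂u_j` with coefficients mod `p`. [folklore] -/
def derivVar (p j : ℕ) (P : Poly) : Poly :=
  normalize p ((P.filter (fun t => t.1.getD j 0 ≠ 0)).map (fun t => (t.1.set j (t.1.getD j 0 - 1), t.2 * t.1.getD j 0)))

/-- `u_j · P`. [folklore] -/
def mulVar (j : ℕ) (P : Poly) : Poly := P.map (fun t => (t.1.set j (t.1.getD j 0 + 1), t.2))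

/-- division by the monomial `u^H` (exponentwise truncated subtraction; exact when `u^H ∣ P`). [folklore] -/
def divMono (H : List ℕ) (P : Poly) : Poly :=
  P.map (fun t => ((List.range t.1.length).map (fun i => t.1.getD i 0 - H.getD i 0), t.2))

/-- `A − B` mod `p`. [folklore] -/
def sub (p : ℕ) (A B : Poly) : Poly := normalize p (A ++ B.map (fun t => (t.1, t.2 * (p - 1))))

/-- zero test after normalisation. [folklore] -/
def isZero (p : ℕ) (A : Poly) : Bool := (normalize p A).isEmpty

/-- `v ∈ Max(G)`: `G(U + v) = G(U)`. [cite: CossartPiltant2019, Def. 2.13] -/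
def inMax (p : ℕ) (v : List ℕ) (G : Poly) : Bool := isZero p (sub p (translate p v G) G)

/-- generators of the cone ideal at `x` for `G = 0`: `H⁻¹ ∂F_{p,Z}/∂U_j` (`j ∉ E`) when `V ≠ 0`,
else `H⁻¹ U_j ∂F_{p,Z}/∂U_j` (`j ∈ E`). [cite: CossartPiltant2019, Prop. 2.16] -/
def coneGens (p m : ℕ) (E : List ℕ) (P : Poly) : List Poly :=
  let Φ := initialForm P
  let H := hVec m E P
  if vNonzero p m E P then ((List.range m).filter (fun j => !(E.contains j))).map (fun j => divMono H (derivVar p j Φ))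
  else E.map (fun j => divMono H (mulVar j (derivVar p j Φ)))

/-- the direction `e_j + Σ_i b_i e_i` of the point `b` of the chart `u_j`. [cite: CossartPiltant2019, Thm. 3.6] -/
def direction (m j : ℕ) (b : List ℕ) : List ℕ := ((List.range m).map (fun i => b.getD i 0)).set j 1

/-- the point `b` of chart `u_j` lies on `P(Max(x))`. [cite: CossartPiltant2019, Thm. 3.6] -/
def onCone (p m : ℕ) (E : List ℕ) (P : Poly) (j : ℕ) (b : List ℕ) : Bool :=
  (coneGens p m E P).all (inMax p (direction m j b))

/-- `P(v)` mod `p`. [folklore] -/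
def evalAt (p : ℕ) (v : List ℕ) (P : Poly) : ℕ :=
  (P.map (fun t => t.2 * ((List.range t.1.length).map (fun i => v.getD i 0 ^ t.1.getD i 0)).prod)).sum % p

/-- additivity `Φ(U + v) = Φ(U) + Φ(v)` of a form along `v`. [cite: CossartJannsenSaito2020, Def. 3.13] -/
def additiveAlong (p m : ℕ) (Φ : Poly) (v : List ℕ) : Bool :=
  isZero p (sub p (sub p (translate p v Φ) Φ) [(List.replicate m 0, evalAt p v Φ)])

/-- the point `b` of chart `u_j` lies on `P(Dir_x X)` for `in(h) = Z^p + F_{p,Z}`, `ord F = p`: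
`(c, v)` with `c^p = −F_{p,Z}(v)` leaves `Z^p + F_{p,Z}` translation invariant iff `F_{p,Z}` is
additive along `v`. [cite: CossartJannsenSaito2020, Thm. 3.14] -/
def onDirectrix (p m : ℕ) (P : Poly) (j : ℕ) (b : List ℕ) : Bool :=
  additiveAlong p m (initialForm P) (direction m j b)

/-! ## Certified rows -/

/-- Hauser's kangaroo `x² + y⁷ + yz⁴` over `𝔽₂`: `(shade, ε, ω) = (5,5,4), (2,2,2), (2,2,2), (3,3,2)`
along `(chart y, 0)`, `(chart z, 0)`, `(chart y, z = 1)` — the shade increases `2 → 3` at the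
kangaroo point while `ω` STALLS (`ε` jumps with the shade; the new initial form `y⁶z³` has
`∂/∂z ≠ 0`, so `ω = ε − 1`). [cite: Hauser2010, §G] -/
theorem hauser_trace :
    trace 2 2 2 [] ⟨hauserF, [0, 0]⟩ hauserPath =
      [some (5, 5, 4), some (2, 2, 2), some (2, 2, 2), some (3, 3, 2)] := by
  decide

/-- At the antelope `y⁵z³ + y³z⁵`, `E = {y, z}`, `H = (3,3)`: `V = 0`, the cone is `Max(J)` with
`J = ⟨y² + z²⟩`, `Max = {v : v_y = v_z}` over `𝔽₂`; the kangaroo point `(chart y, z = 1)` has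
direction `(1,1)` ON the cone (Thm. 3.6, equality case `κ ≥ 2`). [cite: CossartPiltant2019, Thm. 3.6] -/
theorem hauser_kangaroo_onCone : onCone 2 2 [0, 1] [([5, 3], 1), ([3, 5], 1)] 0 [0, 1] = true := by
  decide

/-- … while the origin of the same chart (direction `(1,0)`, where `ω` drops `2 → 0`) is OFF the cone. [cite: CossartPiltant2019, Thm. 3.6] -/
theorem hauser_origin_offCone : onCone 2 2 [0, 1] [([5, 3], 1), ([3, 5], 1)] 0 [0, 0] = false := by
  decide

/-- [CoP 2019, Rem. 2.6] with `p = 3`: `h = Z³ + U₁U₂U₃³ + U₁⁵ + U₂⁵ + c·U₃U₂U₁³`, `E = div(u₁u₂)`: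
`ω = p + 2 = 5` for `c = 0` and `ω = p + 1 = 4` for `c ≠ 0` (`ε = 5` in both cases). [cite: CossartPiltant2019, Rem. 2.6] -/
theorem cp_remark_2_6_p3 :
    (omega 3 3 [0, 1] [([1, 1, 3], 1), ([5, 0, 0], 1), ([0, 5, 0], 1)],
     omega 3 3 [0, 1] [([1, 1, 3], 1), ([5, 0, 0], 1), ([0, 5, 0], 1), ([3, 1, 1], 1)],
     eps 3 [0, 1] [([1, 1, 3], 1), ([5, 0, 0], 1), ([0, 5, 0], 1), ([3, 1, 1], 1)]) = (5, 4, 5) := by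
  decide

/-- [CoP 2019, Rem. 2.6] with `p = 5`: `ω = 7` (`c = 0`), `ω = 6` (`c ≠ 0`). [cite: CossartPiltant2019, Rem. 2.6] -/
theorem cp_remark_2_6_p5 :
    (omega 5 3 [0, 1] [([1, 1, 5], 1), ([7, 0, 0], 1), ([0, 7, 0], 1)],
     omega 5 3 [0, 1] [([1, 1, 5], 1), ([7, 0, 0], 1), ([0, 7, 0], 1), ([5, 1, 1], 1)]) = (7, 6) := by
  decide

/-- [CoP 2019, Rem. 3.2] with `p = 3`, `n = 4`: `h = Z³ + u₄u₁³ + u₃u₂³`, `E = div(u₁u₂u₃)`: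
`ε(x) = 4`, `ω(x) = p = 3`; after the (non-point) blow-up of the remark the same `F` is read with
`E' = div(u₁u₂u₃u₄)` and `ε(x') = ω(x') = p + 1 = 4`. [cite: CossartPiltant2019, Rem. 3.2] -/
theorem cp_remark_3_2_p3 :
    (eps 4 [0, 1, 2] [([3, 0, 0, 1], 1), ([0, 3, 1, 0], 1)],
     omega 3 4 [0, 1, 2] [([3, 0, 0, 1], 1), ([0, 3, 1, 0], 1)],
     omega 3 4 [0, 1, 2, 3] [([3, 0, 0, 1], 1), ([0, 3, 1, 0], 1)]) = (4, 3, 4) := by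
  decide

/-- The atlas' `q = 4` row `x⁴ + y⁹ + z¹⁰` over `𝔽₂` (family `brieskorn-pham-2`, item
`bp-p2e2-y9z10`): along `(chart z, 0)`, `(chart y, 0)`, `(chart y, z = 1)` the triples are
`(9,9,8), (1,1,1), (1,1,1), (2,2,2)` — at the last (kangaroo) point the `p`-derivative analogue
of `ω` INCREASES `1 → 2` (the new initial form `y⁴z²` is a square). Outside the hypothesis
`m(x) = p` of [CoP 2019]; recorded as an atlas computation. [folklore] -/
theorem q4_trace :
    trace 2 4 2 [] ⟨[([9, 0], 1), ([0, 10], 1)], [0, 0]⟩ [(1, [0, 0]), (0, [0, 0]), (0, [0, 1])] =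
      [some (9, 9, 8), some (1, 1, 1), some (1, 1, 1), some (2, 2, 2)] := by
  decide

/-- … whereas the `q`-Hasse analogue (`V ≠ 0` iff some non-boundary exponent is `≢ 0 mod q`)
stalls at `1` there: `z²` is not a fourth power. [folklore] -/
theorem q4_kangaroo_omegaMod4 :
    omegaMod 4 2 [0] [([4, 2], 1), ([4, 6], 1), ([11, 0], 1), ([11, 1], 1), ([11, 4], 1), ([11, 5], 1)] = 1 := by
  decide

end Literature.AlgebraicGeometry.Resolution.KangarooAtlasCert
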